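import Summits.RiemannHypothesis.RiemannHypothesis.Theorems.TiltedLandingLaw421R3Lens1Pinning
import Summits.RiemannHypothesis.RiemannHypothesis.Theorems.TiltedLandingLaw421R3RateSkeleton
import Summits.RiemannHypothesis.RiemannHypothesis.Theses.EarlyAppointments

/-! # trkD_v12q (half) — DRAFT-1a = DRAFT-1 WITHOUT (iii) (lens-2 g7, duty O7-d; V12Q AGENDA (CA642)(B) (i)–(iii)) — skeleton for `TiltedLandingLaw421R` at `halfPurse`
FILE ONLY (`rh33346-cover/lens2/trkD_v12q-DRAFT-1.lean`): the registry `Lines/trkD_v11q.lean` e5f3c2ce is UNCHANGED; a seat with registry rights writes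
`Lines/trkD_v12q.lean` on the directorʼs GO after desk pre-cert.  v11q with exactly three re-typings, all EQUIVALENCES in kernel over TREE theorems:
(i) Γ3/Γ4 SOCKETS IN ∃-BUDGET FORM (the `NonFarSocketsHalfQ` shape, `…R3RateSkeleton` l.273): `stub_energyRiseEx : ∃ aR, EnergyRiseLawQ aR`,
  `stub_consEx : ∃ aC, ConsLawQ aC`.  These are EQUIVALENT to v11qʼs canonical stubs — `(∃ aR, EnergyRiseLawQ aR) ↔ EnergyRiseLawQ riseSupQ` by the tree
  `RhW08.BurgersRateG3.energyRiseLawQ_canonical` (`le_csSup`) / instantiation, likewise `consLawQ_canonical` — so the «typing hole» of (CA642)(B) closes by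
  equivalence, not by weakening: on a legal frame whose charged rises are unbounded NO budget exists, `riseSupQ` is junk 0 AND the ∃-form fails too; the
  lawʼs content in either typing is «rises / overdrafts are bounded frame-wise on legal frames».  The other option named in (i), canonical + a `BddAbove`
  binder, is VACUOUS (`le_csSup` proves it) and is not offered.
(ii) ★A «over explicit budget binders aR aC»: three SEPARATE closed stubs cannot share bound variables; the only budget NAMES the tree has are the least
  ones `riseSupQ`/`consSupQ` (`riseSupQ_le`/`consSupQ_le`: below every admissible budget on a frame with a charged level — junk-free GIVEN (i)), and ★A is
  ANTITONE in both (`approachAllowanceQ_anti`), so ★A at the canonical budgets is the WEAKEST ★A any admissible pair yields (`approachAllowanceQ_canonical`).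
  Hence `stub_approachC` keeps v11qʼs type VERBATIM = glue v4 `RhW08.TouchedGlueL.approachC_of_TL_canonical`ʼs conclusion (critic g26 HANDS l.8158, chain
  3d5c11f5: type identity in kernel); the budget-parametric glue `approachC_of_TL {aR aC}` / `approachC_of_TL_phi` instantiates to it.  A `∀ aR aC, F2 aR →
  C aC → A (aR, aC)` stub would be FALSE-AS-TYPED (the allowance `S₀ − (5/4)E − (5/4)aR − aC + (B+1)/2` is unbounded below in aR) and is not offered.
(iii) SUCC law stub → its residual after lens-1ʼs PROVED DESCENT rung: `stub_topPinningResidual : RhW08.Lens1ArcSign.TopPinningNonNestedAscResidual`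
  (tree `…R3Lens1ArcSignI` §3; `topPinning_iff_nonNestedAscResidual : TopPinning ↔ TopPinningNonNestedAscResidual`, #1171/#1172 Iffs H/I) — the
  crossing-mate class; `TopPinning` by name is recovered inside the composition (`topPinning_of_nonNestedAscResidual`).  ALTERNATE DRAFT-1a keeps
  `stub_topPinning : TopPinning` verbatim (lens-1ʼs call which name the registry carries; the two are interchangeable by the Iff).
NAMESPACE `…Cruxes.TiltedLandingLaw421R.TrkDV12QDraft1a` in this FILE (no clash with a future registry `TrkDV12Q`; the rights seat renames).  STUBS (6 ≤ 7): residual · `RegUmbrella11S` · F1 `FarEnergyLawCQ (4/5)` · F2∃ · C∃ · ★A canonical.  COMPOSITION `TiltedLandingLaw421R_of` re-proved: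
`Exists.elim` ×2 → `energyRiseLawQ_canonical` / `consLawQ_canonical` → `rateLawsHalfQ_of_canonical` → `TiltedLandingLaw421R_of_regHungCut10S` with
`regHungCut10S_of_topPinning (topPinning_of_nonNestedAscResidual …)`.  JOINT CONTENT UNCHANGED vs v11q: stubs 3–6 ⟺ `RateLawsHalfQ`
(`rateLawsHalfQ_iff`, `nonFarSocketsHalfQ_iff_canonical`), stubs 1–2 ⟹ `RegHungCut10S` as before.
Nothing here bears on the truth of RH; RH is not proved; every stub OPEN; ★A / 33346 / 33347 OPEN; checked ≠ landed ≠ proved. -/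

namespace Summit.RiemannHypothesis.RiemannHypothesis.Cruxes.TiltedLandingLaw421R.TrkDV12QDraft1a

set_option linter.dupNamespace false

/-- OPEN SUCC analytic LAW stub (lens-1 P8 / crit-1 L★★★; verbatim v11q): `RhW08.Lens1Pinning.TopPinning`. -/
theorem stub_topPinning : RhW08.Lens1Pinning.TopPinning := by
  sorry

/-- OPEN SUCC residual stub (cell-free, SUCCESSOR conclusion, BAND currency, UMBRELLA end-state): `RhW08.Lens1Pinning.RegUmbrella11S`. -/
theorem stub_regUmbrella11S : RhW08.Lens1Pinning.RegUmbrella11S := by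
  sorry

/-- OPEN RATE stub F1 (lens-2): the far-chain energy law `RhW08.SealSwapQ.FarEnergyLawCQ (4/5)`. -/
theorem stub_farEnergyLawCQ : RhW08.SealSwapQ.FarEnergyLawCQ (4 / 5) := by
  sorry

/-- OPEN RATE stub F2∃ (Γ3 socket, ∃-budget form): SOME explicit rise budget bounds the accumulated energy rises at every charged level of every legal frame
(⟺ v11q `EnergyRiseLawQ riseSupQ` by `RhW08.BurgersRateG3.energyRiseLawQ_canonical`). -/
theorem stub_energyRiseEx : ∃ aR : RhW07.C14.TwoSided.Budget, RhW08.SealSwapQ.EnergyRiseLawQ aR := by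
  sorry

/-- OPEN RATE stub C∃ (Γ4 socket, ∃-budget form): SOME explicit consumption budget bounds the consumption classʼs overdraft at every charged level of every
legal frame (⟺ v11q `ConsLawQ consSupQ` by `RhW08.BurgersRateG3.consLawQ_canonical`). -/
theorem stub_consEx : ∃ aC : RhW07.C14.TwoSided.Budget, RhW08.SealSwapQ.ConsLawQ aC := by
  sorry

/-- OPEN RATE stub Ac = ★A (verbatim v11q; = glue v4 `approachC_of_TL_canonical`ʼs conclusion): the approach allowance at the canonical (least) budgets. -/
theorem stub_approachC :
    RhW08.SealSwapQ.ApproachAllowanceQ (RhW08.RateSplit.approachBudgetHalfQ RhW08.BurgersRateG3.riseSupQ RhW08.BurgersRateG3.consSupQ) := by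
  sorry

/-- The crux BY NAME from the six stubs (`TiltedLandingLaw421R_of_regHungCut10S` ∘ `regHungCut10S_of_topPinning`; rate half `rateLawsHalfQ_of_canonical`
after `energyRiseLawQ_canonical` / `consLawQ_canonical` on the ∃-witnesses). -/
theorem TiltedLandingLaw421R_of : Summit.RiemannHypothesis.RiemannHypothesis.Theses.EarlyAppointments.TiltedLandingLaw421R :=
  stub_energyRiseEx.elim fun _aR hR => stub_consEx.elim fun _aC hC =>
    RhW08.Lens1Coverage.TiltedLandingLaw421R_of_regHungCut10S
      (RhW08.Lens1Pinning.regHungCut10S_of_topPinning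
        stub_topPinning stub_regUmbrella11S)
      (RhW08.BurgersRateG3.rateLawsHalfQ_of_canonical stub_farEnergyLawCQ
        (RhW08.BurgersRateG3.energyRiseLawQ_canonical hR) (RhW08.BurgersRateG3.consLawQ_canonical hC) stub_approachC)

end Summit.RiemannHypothesis.RiemannHypothesis.Cruxes.TiltedLandingLaw421R.TrkDV12QDraft1a
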